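import Summits.BirchSwinnertonDyer.BirchSwinnertonDyer.Theses.PrintCf2
import Summits.BirchSwinnertonDyer.Rank1Residual.WAll.AltClosersCMTwoRamifiedGenusClass
import HarnessLib

/-!
# Route `PrintCf2`, aside stmt-BirchSwinnertonDyer-20471 `RamifiedUPlusOfFactsTYZ` — CLOSED (cell `bsd-print-cf2`, p1)

HONEST FRAMING (cell `bsd-print-cf2`, run/shared/lean/pub/bsd-print-cf2/; route `PrintCf2`, leaf CornerF @ `p = 2` =
`WAllCornerFTwo`, OPEN AS A CLASS): a CLOSING file — it imports the route file and proves ONE item whose statement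
carries its published inputs as an antecedent (facts-relative «OfFacts» typing; nothing asserted, no named fact
introduced). The mathematics is in the seat's W-ALL files `Rank1Residual/WAll/TargetCMTwoRamifiedFamilies.lean`
(p533515), `…/AltClosersCMTwoRamifiedFamilies.lean` (p535702), `…/TargetCMTwoRamifiedOffTYZProved.lean` (p536500),
`…/AltClosersCMTwoRamifiedGenusClass.lean` (p538378); here only the one-line term. Strategy sentence (p1): «Tian–Yuan–Zhang
induction BY NAME … 2-part of BSD for E_n with controlled prime factorisations, typed as class theorems on explicit
infinite families».

THE ITEM (LITERAL-display slice): granted 𝔅_ram ∧ Monsky odd ∧ the Tian–Yuan–Zhang §3 genus-point display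
`tyz_genusPointData` (∃-fact AS PRINTED, A312 — kept out of every crux bundle on purpose), the leaf
`WAllCornerFTwoRamifiedTYZUPlus` — BSD(E,2) for every globally minimal CM rank-one curve with `2` ramified that is a
model of a member of the U⁺-road families `CongruentTYZUPlusFamily` (Tian 2014 class 6 = `E_{2n}`; the ρ-free TYZ
genus class = the per-`n` content of Tian ICM 2022 Thm 8; the `ω = 3` atlas with `s(n) = 1` alone). Closer
`Rank1Residual.WAll.PrintCf2.wAllCornerFTwoRamifiedTYZUPlus_of_facts (hTYZ hGZK h13)` (p538378; Rédei–Reichardt and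
Monsky-odd discharged in the tree). Beyond print: YES, display-conditional (LITERAL-by-name per the cell referee).
[cite: TianYuanZhang2017, Thm. 1.2, Prop. 3.4, Thm. 3.5] [cite: Tian2014, Thm. 1.3 and Thm. 5.2]
[cite: Tian2023CongruentICM, Thm. 8 and Thm. 13] [cite: Miller2011LMS, Def. 1.1]
-/

noncomputable section

open scoped Classical

open Summit.BirchSwinnertonDyer Summit.BirchSwinnertonDyer.Rank1Residual.WAll
open Summit.BirchSwinnertonDyer.BirchSwinnertonDyer.Theses.PrintCf2

set_option autoImplicit false
-- `Summit.BirchSwinnertonDyer.BirchSwinnertonDyer.Theorems` is the layout's namespace (Sub = Summit name).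
set_option linter.dupNamespace false

namespace Summit.BirchSwinnertonDyer.BirchSwinnertonDyer.Theorems

/-- **Aside 20471 `RamifiedUPlusOfFactsTYZ` holds** (facts used: `tyz_genusPointData`, GZK = conjunct 1 and Tian14
Thm 1.3 = conjunct 6 of 𝔅_ram). [cite: TianYuanZhang2017, Prop. 3.4, Thm. 3.5] [cite: Tian2014, Thm. 1.3 and Thm. 5.2] -/
theorem ramifiedUPlusOfFactsTYZ_proof : RamifiedUPlusOfFactsTYZ :=
  fun h ↦ Rank1Residual.WAll.PrintCf2.wAllCornerFTwoRamifiedTYZUPlus_of_facts h.2.2 h.1.1 h.1.2.2.2.2.2.1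

end Summit.BirchSwinnertonDyer.BirchSwinnertonDyer.Theorems

end
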